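import Summits.QuantumFields.QCD.Theorems.HeatSlicedQuarksQuarkLoopCoefficientSecondOrderCoefficientAuxE

/-!
# Quark-loop coefficient, stub `secondOrderCoefficient`, part F: Laplace asymptotics of the free kernel

Helper file of the line `Sketch` of crux stmt-QuantumFields-16786 (stub `stub_secondOrderCoefficient`:
`e2 t → 1/(12π²)` at rate `C/t`).  Elementary Laplace-method estimates for the free kernel
`k_t(w) = (2π)⁻⁴ ∫_{[−π,π]⁴} e^{−t h(p)} cos(p·w) dp` defined in the Defs file, for `t ≥ 1`:

* `∫_{BZ} e^{−t h} |p|² ≤ C/t³`, `∫_{BZ} |e^{−t h} − e^{−t|p|²}| ≤ C/t³`, `∫_{BZᶜ} e^{−t|p|²} ≤ 8/t³`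
  (zone bound `h ≥ (4/π²)|p|²`, Taylor bound `|h − |p|²| ≤ |p|⁴`, sup bounds `y e^{−y} ≤ 1`,
  `y² e^{−y} ≤ 2`, and the Gaussian integral `∫_{ℝ⁴} e^{−b|p|²} = (π/b)²`);
* the site regularity `|k_t(u) − k_t(0)| ≤ C |u|²/t³` (from `1 − cos x ≤ x²/2` and Cauchy–Schwarz);
* the on-diagonal asymptotics `|k_t(0) − 1/(16π²t²)| ≤ C/t³`.

Mathlib + the Defs file + part E (`…SecondOrderCoefficientAuxE`).
-/

noncomputable section

namespace Summit.QuantumFields.QCD.Cruxes.QuarkLoopCoefficient.Sketch.SecondOrderCoefficient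

open MeasureTheory Summit.QuantumFields.QCD.Theorems.QuarkLoopCoefficient
open Literature.Probability.LatticeModels (Site)

/-! ## Laplace-type estimates on the Brillouin zone -/

/-- On the zone the heat factor is dominated by a Gaussian: `e^{−t h(p)} ≤ e^{−(4/π²) t |p|²}` (`t ≥ 0`). -/
theorem exp_neg_mul_hsymb_le {t : ℝ} (ht : 0 ≤ t) {p : Fin 4 → ℝ} (hp : p ∈ brillouin) :
    Real.exp (-(t * hsymb p)) ≤ Real.exp (-(4 / Real.pi ^ 2 * t * ∑ μ, p μ ^ 2)) := by
  rw [Real.exp_le_exp, neg_le_neg_iff, mul_comm (4 / Real.pi ^ 2) t, mul_assoc]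
  exact mul_le_mul_of_nonneg_left (mul_sum_sq_le_hsymb hp) ht

/-- **Second moment of the heat factor**: `∫_{BZ} e^{−t h(p)} |p|² dp ≤ C/t³` for `t ≥ 1`. -/
theorem exists_integral_exp_mul_sum_sq_le :
    ∃ C : ℝ, ∀ t : ℝ, 1 ≤ t →
      ∫ p in brillouin, Real.exp (-(t * hsymb p)) * ∑ μ, p μ ^ 2 ≤ C / t ^ 3 := by
  set c₀ : ℝ := 4 / Real.pi ^ 2 with hc₀
  have hc₀0 : 0 < c₀ := four_div_pi_sq_pos
  refine ⟨2 / c₀ * (Real.pi / (c₀ / 2)) ^ 2, fun t ht => ?_⟩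
  have ht0 : 0 < t := by linarith
  set a : ℝ := c₀ * t / 2 with ha
  have ha0 : 0 < a := by positivity
  -- pointwise domination on the zone
  have hpt : ∀ p ∈ brillouin, Real.exp (-(t * hsymb p)) * ∑ μ, p μ ^ 2 ≤
      2 / (c₀ * t) * Real.exp (-(a * ∑ μ, p μ ^ 2)) := by
    intro p hp
    have hS : 0 ≤ ∑ μ, p μ ^ 2 := Finset.sum_nonneg fun μ _ => sq_nonneg _
    have h1 := exp_neg_mul_hsymb_le ht0.le hp
    have h2 : Real.exp (-(4 / Real.pi ^ 2 * t * ∑ μ, p μ ^ 2)) =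
        Real.exp (-(a * ∑ μ, p μ ^ 2)) * Real.exp (-(a * ∑ μ, p μ ^ 2)) := by
      rw [← Real.exp_add, ha, hc₀]; ring_nf
    have h3 : (a * ∑ μ, p μ ^ 2) * Real.exp (-(a * ∑ μ, p μ ^ 2)) ≤ 1 := mul_exp_neg_le_one _
    calc Real.exp (-(t * hsymb p)) * ∑ μ, p μ ^ 2
        ≤ Real.exp (-(4 / Real.pi ^ 2 * t * ∑ μ, p μ ^ 2)) * ∑ μ, p μ ^ 2 :=
          mul_le_mul_of_nonneg_right h1 hS
      _ = 2 / (c₀ * t) * Real.exp (-(a * ∑ μ, p μ ^ 2)) *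
            ((a * ∑ μ, p μ ^ 2) * Real.exp (-(a * ∑ μ, p μ ^ 2))) := by
          rw [h2, ha]; field_simp
      _ ≤ 2 / (c₀ * t) * Real.exp (-(a * ∑ μ, p μ ^ 2)) * 1 := by gcongr
      _ = _ := mul_one _
  have hf : IntegrableOn (fun p : Fin 4 → ℝ => Real.exp (-(t * hsymb p)) * ∑ μ, p μ ^ 2) brillouin :=
    (Continuous.continuousOn (by have := continuous_hsymb; fun_prop)).integrableOn_compact isCompact_brillouin
  have hg : Integrable (fun p : Fin 4 → ℝ => 2 / (c₀ * t) * Real.exp (-(a * ∑ μ, p μ ^ 2))) :=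
    (integrable_exp_neg_mul_sum_sq ha0).const_mul _
  calc ∫ p in brillouin, Real.exp (-(t * hsymb p)) * ∑ μ, p μ ^ 2
      ≤ ∫ p in brillouin, 2 / (c₀ * t) * Real.exp (-(a * ∑ μ, p μ ^ 2)) :=
        setIntegral_mono_on hf hg.integrableOn measurableSet_brillouin hpt
    _ ≤ ∫ p : Fin 4 → ℝ, 2 / (c₀ * t) * Real.exp (-(a * ∑ μ, p μ ^ 2)) :=
        setIntegral_le_integral hg (Filter.Eventually.of_forall fun p => by positivity)
    _ = 2 / (c₀ * t) * (Real.pi / a) ^ 2 := by rw [integral_const_mul, integral_exp_neg_mul_sum_sq ha0]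
    _ = 2 / c₀ * (Real.pi / (c₀ / 2)) ^ 2 / t ^ 3 := by rw [ha]; field_simp

/-- **Gaussian comparison of the heat factor**: `∫_{BZ} |e^{−t h(p)} − e^{−t|p|²}| dp ≤ C/t³` for `t ≥ 1`
(`|h − |p|²| ≤ |p|⁴`, `min(h, |p|²) ≥ (4/π²)|p|²`, `|e^{−a} − e^{−b}| ≤ |a−b| e^{−min(a,b)}`). -/
theorem exists_integral_abs_exp_sub_exp_le :
    ∃ C : ℝ, ∀ t : ℝ, 1 ≤ t →
      ∫ p in brillouin, |Real.exp (-(t * hsymb p)) - Real.exp (-(t * ∑ μ, p μ ^ 2))| ≤ C / t ^ 3 := by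
  set c₀ : ℝ := 4 / Real.pi ^ 2 with hc₀
  have hc₀0 : 0 < c₀ := four_div_pi_sq_pos
  have hc₀1 : c₀ ≤ 1 := four_div_pi_sq_le_one
  refine ⟨8 / c₀ ^ 2 * (Real.pi / (c₀ / 2)) ^ 2, fun t ht => ?_⟩
  have ht0 : 0 < t := by linarith
  set a : ℝ := c₀ * t / 2 with ha
  have ha0 : 0 < a := by positivity
  have hpt : ∀ p ∈ brillouin, |Real.exp (-(t * hsymb p)) - Real.exp (-(t * ∑ μ, p μ ^ 2))| ≤
      8 / (c₀ ^ 2 * t) * Real.exp (-(a * ∑ μ, p μ ^ 2)) := by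
    intro p hp
    set S : ℝ := ∑ μ, p μ ^ 2 with hS
    have hS0 : 0 ≤ S := Finset.sum_nonneg fun μ _ => sq_nonneg _
    have hmin : c₀ * t * S ≤ min (t * hsymb p) (t * S) := by
      refine le_min ?_ ?_
      · have h := mul_sum_sq_le_hsymb hp
        rw [← hc₀, ← hS] at h
        calc c₀ * t * S = t * (c₀ * S) := by ring
          _ ≤ t * hsymb p := mul_le_mul_of_nonneg_left h ht0.le
      · have h := mul_le_mul_of_nonneg_right hc₀1 (by positivity : 0 ≤ t * S)
        calc c₀ * t * S = c₀ * (t * S) := by ring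
          _ ≤ 1 * (t * S) := h
          _ = t * S := one_mul _
    have h1 := abs_exp_neg_sub_exp_neg_le (t * hsymb p) (t * S)
    have h2 : |t * hsymb p - t * S| ≤ t * S ^ 2 := by
      rw [← mul_sub, abs_mul, abs_of_pos ht0]
      exact mul_le_mul_of_nonneg_left (abs_hsymb_sub_sum_sq_le p) ht0.le
    have h3 : Real.exp (-min (t * hsymb p) (t * S)) ≤ Real.exp (-(a * S)) * Real.exp (-(a * S)) := by
      rw [← Real.exp_add, Real.exp_le_exp, ha]
      linarith
    have h4 : (a * S) ^ 2 * Real.exp (-(a * S)) ≤ 2 := sq_mul_exp_neg_le_two (by positivity)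
    calc |Real.exp (-(t * hsymb p)) - Real.exp (-(t * S))|
        ≤ |t * hsymb p - t * S| * Real.exp (-min (t * hsymb p) (t * S)) := h1
      _ ≤ t * S ^ 2 * (Real.exp (-(a * S)) * Real.exp (-(a * S))) :=
          mul_le_mul h2 h3 (Real.exp_nonneg _) (by positivity)
      _ = 4 / (c₀ ^ 2 * t) * Real.exp (-(a * S)) * ((a * S) ^ 2 * Real.exp (-(a * S))) := by
          rw [ha]; field_simp; ring
      _ ≤ 4 / (c₀ ^ 2 * t) * Real.exp (-(a * S)) * 2 := by gcongr
      _ = 8 / (c₀ ^ 2 * t) * Real.exp (-(a * S)) := by ring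
  have hf : IntegrableOn
      (fun p : Fin 4 → ℝ => |Real.exp (-(t * hsymb p)) - Real.exp (-(t * ∑ μ, p μ ^ 2))|) brillouin :=
    (Continuous.continuousOn (by have := continuous_hsymb; fun_prop)).integrableOn_compact isCompact_brillouin
  have hg : Integrable (fun p : Fin 4 → ℝ => 8 / (c₀ ^ 2 * t) * Real.exp (-(a * ∑ μ, p μ ^ 2))) :=
    (integrable_exp_neg_mul_sum_sq ha0).const_mul _
  calc ∫ p in brillouin, |Real.exp (-(t * hsymb p)) - Real.exp (-(t * ∑ μ, p μ ^ 2))|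
      ≤ ∫ p in brillouin, 8 / (c₀ ^ 2 * t) * Real.exp (-(a * ∑ μ, p μ ^ 2)) :=
        setIntegral_mono_on hf hg.integrableOn measurableSet_brillouin hpt
    _ ≤ ∫ p : Fin 4 → ℝ, 8 / (c₀ ^ 2 * t) * Real.exp (-(a * ∑ μ, p μ ^ 2)) :=
        setIntegral_le_integral hg (Filter.Eventually.of_forall fun p => by positivity)
    _ = 8 / (c₀ ^ 2 * t) * (Real.pi / a) ^ 2 := by rw [integral_const_mul, integral_exp_neg_mul_sum_sq ha0]
    _ = 8 / c₀ ^ 2 * (Real.pi / (c₀ / 2)) ^ 2 / t ^ 3 := by rw [ha]; field_simp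

/-- **Gaussian tail off the zone**: `∫_{BZᶜ} e^{−t|p|²} dp ≤ 8/t³` for `t ≥ 1` (some `|p_μ| > π`, so
`e^{−t|p|²} ≤ e^{−tπ²/2} e^{−t|p|²/2}` and `e^{−tπ²/2} ≤ 2/(tπ²)`). -/
theorem integral_compl_brillouin_exp_le {t : ℝ} (ht : 1 ≤ t) :
    ∫ p in brillouinᶜ, Real.exp (-(t * ∑ μ, p μ ^ 2)) ≤ 8 / t ^ 3 := by
  have ht0 : 0 < t := by linarith
  have ha0 : 0 < t / 2 := by positivity
  have hpt : ∀ p ∈ brillouinᶜ, Real.exp (-(t * ∑ μ, p μ ^ 2)) ≤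
      2 / (t * Real.pi ^ 2) * Real.exp (-(t / 2 * ∑ μ, p μ ^ 2)) := by
    intro p hp
    obtain ⟨ν, hν⟩ := exists_pi_lt_abs_of_not_mem_brillouin hp
    have hS : Real.pi ^ 2 ≤ ∑ μ, p μ ^ 2 := by
      have h1 : Real.pi ^ 2 ≤ p ν ^ 2 := by
        rw [← sq_abs (p ν)]; exact pow_le_pow_left₀ Real.pi_pos.le hν.le 2
      exact h1.trans (Finset.single_le_sum (fun μ _ => sq_nonneg (p μ)) (Finset.mem_univ ν))
    have h2 : Real.exp (-(t * ∑ μ, p μ ^ 2)) =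
        Real.exp (-(t / 2 * ∑ μ, p μ ^ 2)) * Real.exp (-(t / 2 * ∑ μ, p μ ^ 2)) := by
      rw [← Real.exp_add]; ring_nf
    have h3 : Real.exp (-(t / 2 * ∑ μ, p μ ^ 2)) ≤ Real.exp (-(t * Real.pi ^ 2 / 2)) := by
      rw [Real.exp_le_exp]; nlinarith
    have h4 : Real.exp (-(t * Real.pi ^ 2 / 2)) ≤ 2 / (t * Real.pi ^ 2) := by
      have h5 := mul_exp_neg_le_one (t * Real.pi ^ 2 / 2)
      rw [le_div_iff₀ (by positivity)]
      nlinarith [Real.exp_nonneg (-(t * Real.pi ^ 2 / 2))]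
    calc Real.exp (-(t * ∑ μ, p μ ^ 2))
        = Real.exp (-(t / 2 * ∑ μ, p μ ^ 2)) * Real.exp (-(t / 2 * ∑ μ, p μ ^ 2)) := h2
      _ ≤ 2 / (t * Real.pi ^ 2) * Real.exp (-(t / 2 * ∑ μ, p μ ^ 2)) :=
          mul_le_mul_of_nonneg_right (h3.trans h4) (Real.exp_nonneg _)
  have hf : Integrable (fun p : Fin 4 → ℝ => Real.exp (-(t * ∑ μ, p μ ^ 2))) :=
    integrable_exp_neg_mul_sum_sq ht0
  have hg : Integrable (fun p : Fin 4 → ℝ => 2 / (t * Real.pi ^ 2) * Real.exp (-(t / 2 * ∑ μ, p μ ^ 2))) :=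
    (integrable_exp_neg_mul_sum_sq ha0).const_mul _
  calc ∫ p in brillouinᶜ, Real.exp (-(t * ∑ μ, p μ ^ 2))
      ≤ ∫ p in brillouinᶜ, 2 / (t * Real.pi ^ 2) * Real.exp (-(t / 2 * ∑ μ, p μ ^ 2)) :=
        setIntegral_mono_on hf.integrableOn hg.integrableOn measurableSet_brillouin.compl hpt
    _ ≤ ∫ p : Fin 4 → ℝ, 2 / (t * Real.pi ^ 2) * Real.exp (-(t / 2 * ∑ μ, p μ ^ 2)) :=
        setIntegral_le_integral hg (Filter.Eventually.of_forall fun p => by positivity)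
    _ = 2 / (t * Real.pi ^ 2) * (Real.pi / (t / 2)) ^ 2 := by
        rw [integral_const_mul, integral_exp_neg_mul_sum_sq ha0]
    _ = 8 / t ^ 3 := by field_simp; ring

/-! ## The free kernel: regularity in the site and the on-diagonal asymptotics -/

/-- `(p·u)² ≤ |p|² |u|²` with `|u|² = elen(u)²`. -/
theorem sq_sum_mul_le (p : Fin 4 → ℝ) (u : Site 4) :
    (∑ μ, p μ * ((u μ : ℤ) : ℝ)) ^ 2 ≤ (∑ μ, p μ ^ 2) * elen u ^ 2 := by
  have h := Finset.sum_mul_sq_le_sq_mul_sq Finset.univ p (fun μ => ((u μ : ℤ) : ℝ))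
  have he : elen u ^ 2 = ∑ μ, ((u μ : ℤ) : ℝ) ^ 2 := by
    unfold elen; rw [Real.sq_sqrt (Finset.sum_nonneg fun μ _ => sq_nonneg _)]
  rw [he]; exact h

/-- **Site regularity of the free kernel**: `|k_t(u) − k_t(0)| ≤ C |u|²/t³` for `t ≥ 1`. -/
theorem exists_abs_freeKer_sub_freeKer_zero_le :
    ∃ C : ℝ, ∀ t : ℝ, 1 ≤ t → ∀ u : Site 4, |freeKer t u - freeKer t 0| ≤ C * elen u ^ 2 / t ^ 3 := by
  obtain ⟨C₁, hC₁⟩ := exists_integral_exp_mul_sum_sq_le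
  refine ⟨((2 * Real.pi)⁻¹) ^ 4 * (C₁ / 2), fun t ht u => ?_⟩
  have ht0 : 0 < t := by linarith
  have hcont : ∀ w : Site 4, Continuous fun p : Fin 4 → ℝ =>
      Real.exp (-(t * hsymb p)) * Real.cos (∑ μ, p μ * ((w μ : ℤ) : ℝ)) := fun w => by
    have := continuous_hsymb; fun_prop
  have hint : ∀ w : Site 4, IntegrableOn (fun p : Fin 4 → ℝ =>
      Real.exp (-(t * hsymb p)) * Real.cos (∑ μ, p μ * ((w μ : ℤ) : ℝ))) brillouin := fun w =>
    (hcont w).continuousOn.integrableOn_compact isCompact_brillouin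
  have hdiff : freeKer t u - freeKer t 0 = ((2 * Real.pi)⁻¹) ^ 4 * ∫ p in brillouin,
      Real.exp (-(t * hsymb p)) * (Real.cos (∑ μ, p μ * ((u μ : ℤ) : ℝ)) - 1) := by
    unfold freeKer
    rw [← mul_sub, ← integral_sub (hint u) (hint 0)]
    congr 1
    refine setIntegral_congr_fun measurableSet_brillouin fun p _ => ?_
    simp only [Pi.zero_apply, Int.cast_zero, mul_zero, Finset.sum_const_zero, Real.cos_zero]
    ring
  have hpt : ∀ p ∈ brillouin, ‖Real.exp (-(t * hsymb p)) * (Real.cos (∑ μ, p μ * ((u μ : ℤ) : ℝ)) - 1)‖ ≤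
      elen u ^ 2 / 2 * (Real.exp (-(t * hsymb p)) * ∑ μ, p μ ^ 2) := by
    intro p _
    rw [Real.norm_eq_abs, abs_mul, abs_of_pos (Real.exp_pos _)]
    have h1 : ∀ x : ℝ, |Real.cos x - 1| ≤ x ^ 2 / 2 := fun x => by
      rw [abs_sub_comm, abs_of_nonneg (by have := Real.cos_le_one x; linarith)]
      exact one_sub_cos_le_sq_div_two x
    have h1 := h1 (∑ μ, p μ * ((u μ : ℤ) : ℝ))
    have h2 := sq_sum_mul_le p u
    have h3 : |Real.cos (∑ μ, p μ * ((u μ : ℤ) : ℝ)) - 1| ≤ elen u ^ 2 / 2 * ∑ μ, p μ ^ 2 := by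
      nlinarith
    calc Real.exp (-(t * hsymb p)) * |Real.cos (∑ μ, p μ * ((u μ : ℤ) : ℝ)) - 1|
        ≤ Real.exp (-(t * hsymb p)) * (elen u ^ 2 / 2 * ∑ μ, p μ ^ 2) :=
          mul_le_mul_of_nonneg_left h3 (Real.exp_nonneg _)
      _ = _ := by ring
  have hgi : IntegrableOn (fun p : Fin 4 → ℝ => elen u ^ 2 / 2 * (Real.exp (-(t * hsymb p)) * ∑ μ, p μ ^ 2))
      brillouin :=
    (Continuous.continuousOn (by have := continuous_hsymb; fun_prop)).integrableOn_compact isCompact_brillouin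
  have hI := norm_integral_le_of_norm_le hgi
    ((ae_restrict_iff' measurableSet_brillouin).2 (Filter.Eventually.of_forall hpt))
  rw [integral_const_mul] at hI
  rw [hdiff, abs_mul, abs_of_pos (by positivity)]
  calc ((2 * Real.pi)⁻¹) ^ 4 * |∫ p in brillouin,
        Real.exp (-(t * hsymb p)) * (Real.cos (∑ μ, p μ * ((u μ : ℤ) : ℝ)) - 1)|
      ≤ ((2 * Real.pi)⁻¹) ^ 4 * (elen u ^ 2 / 2 * ∫ p in brillouin, Real.exp (-(t * hsymb p)) * ∑ μ, p μ ^ 2) :=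
        mul_le_mul_of_nonneg_left hI (by positivity)
    _ ≤ ((2 * Real.pi)⁻¹) ^ 4 * (elen u ^ 2 / 2 * (C₁ / t ^ 3)) := by
        gcongr
        exact hC₁ t ht
    _ = ((2 * Real.pi)⁻¹) ^ 4 * (C₁ / 2) * elen u ^ 2 / t ^ 3 := by ring

/-- **On-diagonal asymptotics of the free kernel**: `|k_t(0) − 1/(16π²t²)| ≤ C/t³` for `t ≥ 1`
(Gaussian comparison on the zone, Gaussian tail off the zone, `∫_{ℝ⁴} e^{−t|p|²} = π²/t²`). -/
theorem exists_abs_freeKer_zero_sub_le :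
    ∃ C : ℝ, ∀ t : ℝ, 1 ≤ t → |freeKer t 0 - 1 / (16 * Real.pi ^ 2 * t ^ 2)| ≤ C / t ^ 3 := by
  obtain ⟨C₂, hC₂⟩ := exists_integral_abs_exp_sub_exp_le
  refine ⟨((2 * Real.pi)⁻¹) ^ 4 * (C₂ + 8), fun t ht => ?_⟩
  have ht0 : 0 < t := by linarith
  -- the three integrals
  have hfi : IntegrableOn (fun p : Fin 4 → ℝ => Real.exp (-(t * hsymb p))) brillouin :=
    (Continuous.continuousOn (by have := continuous_hsymb; fun_prop)).integrableOn_compact isCompact_brillouin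
  have hgi : Integrable (fun p : Fin 4 → ℝ => Real.exp (-(t * ∑ μ, p μ ^ 2))) :=
    integrable_exp_neg_mul_sum_sq ht0
  have hk0 : freeKer t 0 = ((2 * Real.pi)⁻¹) ^ 4 * ∫ p in brillouin, Real.exp (-(t * hsymb p)) := by
    unfold freeKer
    congr 1
    refine setIntegral_congr_fun measurableSet_brillouin fun p _ => ?_
    simp only [Pi.zero_apply, Int.cast_zero, mul_zero, Finset.sum_const_zero, Real.cos_zero, mul_one]
  have hG : ∫ p : Fin 4 → ℝ, Real.exp (-(t * ∑ μ, p μ ^ 2)) = (Real.pi / t) ^ 2 :=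
    integral_exp_neg_mul_sum_sq ht0
  have hsplit := integral_add_compl measurableSet_brillouin hgi
  have htarget : 1 / (16 * Real.pi ^ 2 * t ^ 2) = ((2 * Real.pi)⁻¹) ^ 4 * (Real.pi / t) ^ 2 := by
    field_simp; ring
  -- `k_t(0) − target = c4 [ ∫_BZ (e^{-th} − e^{-t|p|²}) − ∫_{BZᶜ} e^{-t|p|²} ]`
  have hdec : freeKer t 0 - 1 / (16 * Real.pi ^ 2 * t ^ 2) = ((2 * Real.pi)⁻¹) ^ 4 *
      ((∫ p in brillouin, (Real.exp (-(t * hsymb p)) - Real.exp (-(t * ∑ μ, p μ ^ 2)))) -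
        ∫ p in brillouinᶜ, Real.exp (-(t * ∑ μ, p μ ^ 2))) := by
    rw [hk0, htarget, ← hG, ← hsplit, integral_sub hfi hgi.integrableOn]
    ring
  rw [hdec, abs_mul, abs_of_pos (by positivity), mul_div_assoc]
  refine mul_le_mul_of_nonneg_left ?_ (by positivity)
  have h1 : |∫ p in brillouin, (Real.exp (-(t * hsymb p)) - Real.exp (-(t * ∑ μ, p μ ^ 2)))| ≤ C₂ / t ^ 3 :=
    (abs_integral_le_integral_abs).trans (hC₂ t ht)
  have h2 : |∫ p in brillouinᶜ, Real.exp (-(t * ∑ μ, p μ ^ 2))| ≤ 8 / t ^ 3 := by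
    rw [abs_of_nonneg (integral_nonneg fun p => (Real.exp_nonneg _))]
    exact integral_compl_brillouin_exp_le ht
  calc |(∫ p in brillouin, (Real.exp (-(t * hsymb p)) - Real.exp (-(t * ∑ μ, p μ ^ 2)))) -
        ∫ p in brillouinᶜ, Real.exp (-(t * ∑ μ, p μ ^ 2))|
      ≤ |∫ p in brillouin, (Real.exp (-(t * hsymb p)) - Real.exp (-(t * ∑ μ, p μ ^ 2)))| +
          |∫ p in brillouinᶜ, Real.exp (-(t * ∑ μ, p μ ^ 2))| := abs_sub _ _
    _ ≤ C₂ / t ^ 3 + 8 / t ^ 3 := add_le_add h1 h2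
    _ = (C₂ + 8) / t ^ 3 := by ring

/-! ## Registered headline -/

/-- Registered headline of this helper file (aux stub `stub_secondOrderCoefficientAuxF` of crux
stmt-QuantumFields-16786, line `Sketch`): the on-diagonal asymptotics of the free kernel. -/
theorem stub_secondOrderCoefficientAuxF :
    ∃ C : ℝ, ∀ t : ℝ, 1 ≤ t → |freeKer t 0 - 1 / (16 * Real.pi ^ 2 * t ^ 2)| ≤ C / t ^ 3 :=
  exists_abs_freeKer_zero_sub_le

end Summit.QuantumFields.QCD.Cruxes.QuarkLoopCoefficient.Sketch.SecondOrderCoefficient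

end
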